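import Summits.ResolutionOfSingularities.ResolutionOfSingularities.Theorems.WildDescent14
import Summits.ResolutionOfSingularities.ResolutionOfSingularities.Theorems.LossEntryW33
import HarnessLib

/-!
# DefectWalksDeepHolds — the Theses item `MaxContactCut.DefectWalksDeep` (stmt-ResolutionOfSingularities-31770) closed BY NAME

Bookkeeping composition (decomp-res census, critic rows 230 / 250): the |σ| = 3 model column's aside
`MaxContactCut.DefectWalksDeep` is EXACTLY the LOSSY strict cell `WallCut.NoLossyStrictTailsDeep`
(`WildDescent.defectWalksDeep_iff_lossy`, Theorems/WildDescent14), and the lossy cell is a hypothesis-free theorem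
(`LossEpisode.noLossyStrictTailsDeep`, Theorems/LossEntryW33, lens-3 «LossEntryWalk», CJS2020 Lemma 13.4 for the forced walk).
No new mathematics; one composition.
-/

set_option linter.dupNamespace false

namespace Summit.ResolutionOfSingularities.ResolutionOfSingularities.Theorems.DefectWalksDeepHolds

open Summit.ResolutionOfSingularities.ResolutionOfSingularities.Theorems

/-- **Item 31770 `MaxContactCut.DefectWalksDeep` holds** (deep CJS defect walks terminate, |σ| = 3 model column):
the located residual is the lossy strict cell (`WildDescent.defectWalksDeep_iff_lossy`, hypothesis-free since
`WallFrames.balancedWallPort_holds` and `WildDescent.noWildBalancedStrictTailsDeep_holds`), and the lossy cell is empty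
(`LossEpisode.noLossyStrictTailsDeep`). [new; composition of landed theorems] [cite: CossartJannsenSaito2020, Lemma 13.4]
[cite: Kollar2007, 2.59] -/
theorem defectWalksDeep_holds :
    Summit.ResolutionOfSingularities.ResolutionOfSingularities.Theses.MaxContactCut.DefectWalksDeep :=
  WildDescent.defectWalksDeep_of_lossy' LossEpisode.noLossyStrictTailsDeep

end Summit.ResolutionOfSingularities.ResolutionOfSingularities.Theorems.DefectWalksDeepHolds
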